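import Summits.BirchSwinnertonDyer.Rank1Residual.P2.CornerFTwoModelOffTYZ
import HarnessLib
import HarnessLib.Audit.Tags

/-!
# Rung W-ALL of ladder BSD (D-0120) — the ramified slice of row 12₂: MONSKY'S FAMILY `𝒮⁻` CARVED OUT OF THE
# RESIDUAL OF THE p1 ROAD, BY NAME (cell `bsd-print-cf2`, D-0131 (2) PRINT TIER, seat p1; crux
# stmt-BirchSwinnertonDyer-20509 `RamifiedOffTYZOfFacts` of route `PrintCf2`)

HONEST FRAMING (cell `bsd-print-cf2`, run/shared/lean/pub/bsd-print-cf2/; partition leaf «CornerF @ `p = 2`» =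
`Summit.BirchSwinnertonDyer.WAllCornerFTwo`, OPEN AS A CLASS): STATEMENTS AND BOOKKEEPING ONLY — nothing asserted,
nothing booked, no named fact introduced, no published theorem restated. `WAll/TargetCMTwoRamifiedFamilies.lean`
(p533515) cuts the ramified slice `WAllCornerFTwoRamified` by the Tian–Yuan–Zhang congruent-number families and names
the four-way residual `WAllCornerFTwoRamifiedOffTYZ`; `WAll/TargetCMTwoRamifiedOffTYZProved.lean` (p536500) names the
FLAG-FREE residual `WAllCornerFTwoRamifiedOffTYZProved` (= the conclusion of crux 20509, `𝔅_ram → …`). Both residuals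
CONTAIN Monsky's family `𝒮⁻ = {E_{2pq} : p ≡ 5 (8), q ≡ 3 (4), (p/q) = −1}` (even parameter: outside LLT / T5 / T7 /
M35 / TYZρ, which are models of `E_m` with `m` odd — PROVED below, `not_congruentTYZProvedFamily_of_…`; outside Tian's
class 6, whose odd primes are `≡ 3 (4), ≡ 1 (8)`; the half of the even two-prime family on which TYZ Thm 1.2 is silent,
cell `bsd-monsky` README §1/§3). On `𝒮⁻` the tree PROVES `ord_{s=1} L(E_{2pq}, s) = 1 ∧ BSD(E_{2pq}, 2)` modulo two
named facts that are CONJUNCTS 10 and 11 OF THE ROUTE'S BUNDLE `𝔅_ram` — Heath-Brown 1994's even Selmer count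
(`HeathBrown1994.monsky_card_selmerGroup_two_even`) and Tian's CM-point system on `𝒮⁻` in genus form
(`Tian2014.tian2014_system_sMinus_genus`): `P2.congruentSilentEvenFiveBSDTwo_of_genusSystem_of_monskyEven` (cell
`bsd-monsky`, `P2/CongruentNumberSilentEvenFiveEnclosureMonskyEven.lean`). So `𝒮⁻` is a slice of the residual the route
can close INSIDE its flag-free bundle, and this file names it: the membership predicate `CongruentMonskySMinusFamily`
(§1), the leaf `WAllCornerFTwoRamifiedSMinus` and the two residuals with `𝒮⁻` carved out —
`WAllCornerFTwoRamifiedOffTYZProvedOffSMinus` (flag-free road) and `WAllCornerFTwoRamifiedOffTYZOffSMinus` (five-way)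
(§2) — membership facts incl. the disjointness from the proved TYZ families (§3), and the glue (§4, excluded middle on
membership; the disjointness makes the flag-free cut EXACT with the UNRESTRICTED `𝒮⁻` leaf):
`wAllCornerFTwoRamifiedOffTYZProved_iff_sMinus_offSMinus`, `wAllCornerFTwoRamified_iff_tyzProved_sMinus_offSMinus`,
`wAllCornerFTwoRamifiedOffTYZ_iff_onSMinus_offSMinus`, and the four-leaf composition
`wAllCornerFTwoRamifiedOffTYZProved_of_uPlus_of_atlasFJ_of_sMinus_of_offSMinus` used by the reshaped skeleton of crux
20509. The closer `PrintCf2.wAllCornerFTwoRamifiedSMinus_of_facts` and the proved stub land in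
`Summits/BirchSwinnertonDyer/BirchSwinnertonDyer/Theorems/PrintCf2RamifiedOffTYZSMinusLeaf.lean` (seat p1).

WHY (seat p1, strategy «Tian–Yuan–Zhang induction BY NAME: Heegner points + genus theory + Gross–Zagier/Waldspurger ⇒
2-part of BSD for `E_n` with controlled prime factorisations (Tian 2014; Tian–Yuan–Zhang 2017), typed as class theorems on
explicit infinite families»): `𝒮⁻` is an explicit infinite family of `E_n` on which BSD(E,2) follows from Tian's
induction framework (the CM-point system of Tian 2014 Thm 2.8, its Gross–Zagier index relation, Gauss genus theory)
plus a 2-descent count; beyond print — Monsky 1990 p. 67 Remark (3) CONJECTURED it; no printed proof exists.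

References: `WAll/TargetCMTwoRamifiedFamilies.lean` (p533515), `WAll/TargetCMTwoRamifiedOffTYZProved.lean` (p536500),
`P2/CornerFTwoModelOffTYZ.lean` (ty2: uniqueness of the square-free parameter of a model),
`P2/Conjectures/CongruentNumberSilentEvenFiveAtTwo.lean` (C-P2-1), `P2/CongruentNumberSilentEvenFiveEnclosureMonskyEven.lean`
(cell `bsd-monsky`), route file `Summits/BirchSwinnertonDyer/BirchSwinnertonDyer/Theses/PrintCf2.lean` (item 20509).
[cite: Monsky1990MockHeegner, p. 67 Remark (3)] [cite: Tian2014, Thm. 2.8] [cite: HeathBrown1994SelmerCongruentII,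
Appendix (Monsky)] [cite: Miller2011LMS, §1 and Def. 1.1] (the currency `BSD(E,p)`).
-/

noncomputable section

open scoped Classical

open WeierstrassCurve Literature.NumberTheory.EllipticCurves
  Literature.NumberTheory.EllipticCurves.Rank1Residual
open Summit.BirchSwinnertonDyer.Rank1Residual

set_option autoImplicit false

namespace Summit.BirchSwinnertonDyer

/-! ### §1. Membership predicate: Monsky's family `𝒮⁻` (up to `ℚ`-isomorphism) -/

/-- **Monsky's family `𝒮⁻`** as a class at `2`: `W` is a `ℚ`-model of `E_{2pq} : y² = x³ − (2pq)²x` with `p`, `q`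
primes, `p ≡ 5 (mod 8)`, `q ≡ 3 (mod 4)` and `(p/q) = −1` — the half of the even two-prime family on which Monsky
(Math. Z. 204 (1990), p. 67 Remark (3)) CONJECTURED that the mock-Heegner point has infinite order and odd index, and on
which the Tian–Yuan–Zhang parity criterion is silent (cell `bsd-monsky`, README §1/§3; tree conjecture
`P2.Conjectures.CongruentSilentEvenFiveBSDTwo`). A predicate; nothing asserted.
[cite: Monsky1990MockHeegner, p. 67 Remark (3)] [cite: Tian2014, Thm. 2.8] -/
def CongruentMonskySMinusFamily : P2.ClassAtTwo := fun W _ _ =>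
  ∃ p q : ℕ, p.Prime ∧ q.Prime ∧ p % 8 = 5 ∧ q % 4 = 3 ∧ jacobiSym p q = -1 ∧
    ∃ C : VariableChange ℚ, C • congruentNumberCurve (2 * (p * q)) = W

/-! ### §2. Leaves: the `𝒮⁻` slice and the residuals off it -/

/-- **Ramified slice ON MONSKY'S FAMILY `𝒮⁻`** (closed INSIDE the route's flag-free bundle `𝔅_ram` by
`PrintCf2.wAllCornerFTwoRamifiedSMinus_of_facts`: Heath-Brown 1994's even Selmer count + Tian's CM-point system on `𝒮⁻`
in genus form): CM, `ord_{s=1} L(E,s) = 1`, `2 ∣ d_K`, `W ∈ CongruentMonskySMinusFamily` ⇒ `BSD(E,2)`. [folklore] -/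
@[conjecture] def WAllCornerFTwoRamifiedSMinus : Prop :=
  ∀ (W : WeierstrassCurve ℚ) [W.IsElliptic] [W.IsGloballyMinimal],
    W.HasCM → W.analyticRank = 1 → CMRamified W 2 → CongruentMonskySMinusFamily W → BSDp W 2

/-- **Flag-free residual OFF the proved TYZ families AND OFF `𝒮⁻` (OPEN)** — the residual of the FLAG-FREE p1 road
after the `𝒮⁻` carve-out: CM, `r_an = 1`, `2 ∣ d_K`, `W` a `ℚ`-model of no member of `CongruentTYZProvedFamily` and of no
member of `CongruentMonskySMinusFamily` ⇒ `BSD(E,2)`. Still contains the U⁺-road / FJ-atlas leaves (closable only beyond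
`𝔅_ram` resp. closed), every quartic twist `y² = x³ + Ax` with `−A ∉ ℤ²`, every other `E_m`, every `j = 287496` and every
`j = 8000` curve of analytic rank one. No theorem in print. [folklore] -/
@[conjecture] def WAllCornerFTwoRamifiedOffTYZProvedOffSMinus : Prop :=
  ∀ (W : WeierstrassCurve ℚ) [W.IsElliptic] [W.IsGloballyMinimal],
    W.HasCM → W.analyticRank = 1 → CMRamified W 2 → ¬ CongruentTYZProvedFamily W →
      ¬ CongruentMonskySMinusFamily W → BSDp W 2

/-- **Five-way residual: OFF the three TYZ family predicates AND OFF `𝒮⁻` (OPEN)** — the four-way residual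
`WAllCornerFTwoRamifiedOffTYZ` of `WAll/TargetCMTwoRamifiedFamilies.lean` with Monsky's `𝒮⁻` carved out as well. No
theorem in print. [folklore] -/
@[conjecture] def WAllCornerFTwoRamifiedOffTYZOffSMinus : Prop :=
  ∀ (W : WeierstrassCurve ℚ) [W.IsElliptic] [W.IsGloballyMinimal],
    W.HasCM → W.analyticRank = 1 → CMRamified W 2 →
      ¬ CongruentTYZProvedFamily W → ¬ CongruentTYZUPlusFamily W → ¬ CongruentTYZAtlasFJFamily W →
      ¬ CongruentMonskySMinusFamily W → BSDp W 2

/-! ### §3. Membership facts: `𝒮⁻` lies in the ramified slice and is disjoint from the proved TYZ families -/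

/-- The parameter `2pq` of a member of `𝒮⁻` is square-free (`p ≡ 5 (8)` and `q ≡ 3 (4)` are distinct odd primes).
[folklore] -/
theorem squarefree_two_mul_mul_of_sMinus {p q : ℕ} (hp : p.Prime) (hq : q.Prime) (hp8 : p % 8 = 5)
    (hq4 : q % 4 = 3) : Squarefree (2 * (p * q)) := by
  have cop : ∀ {a b : ℕ}, a.Prime → b.Prime → a ≠ b → a.Coprime b :=
    fun ha hb hab => (Nat.coprime_primes ha hb).mpr hab
  have hp2 : 2 ≠ p := by rintro rfl; omega
  have hq2 : 2 ≠ q := by rintro rfl; omega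
  have hne : p ≠ q := by rintro rfl; omega
  refine Nat.squarefree_mul_iff.mpr ⟨?_, Nat.prime_two.squarefree, ?_⟩
  · exact Nat.Coprime.mul_right (cop Nat.prime_two hp hp2) (cop Nat.prime_two hq hq2)
  · exact Nat.squarefree_mul_iff.mpr ⟨cop hp hq hne, hp.squarefree, hq.squarefree⟩

/-- Every member of `CongruentMonskySMinusFamily` has CM by `ℤ[i]` with `2` ramified (`j = 1728`): the family lies in
the ramified slice. [folklore] -/
theorem hasCM_and_cmRamified_two_of_congruentMonskySMinusFamily {W : WeierstrassCurve ℚ} [W.IsElliptic]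
    [W.IsGloballyMinimal] (h : CongruentMonskySMinusFamily W) : W.HasCM ∧ CMRamified W 2 := by
  obtain ⟨p, q, hp, hq, hp8, hq4, -, C, hC⟩ := h
  exact hasCM_and_cmRamified_two_of_smul_congruentNumberCurve
    (squarefree_two_mul_mul_of_sMinus hp hq hp8 hq4).ne_zero hC

/-- A product of naturals all `≡ 1 (mod 2)` is odd. [folklore] -/
private theorem prod_mod_two_eq_one {k : ℕ} {p : Fin (k + 1) → ℕ} (h : ∀ i, p i % 2 = 1) :
    (∏ i, p i) % 2 = 1 := by
  rw [Finset.prod_nat_mod, Finset.prod_congr rfl fun i _ => h i, Finset.prod_const_one]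
  rfl

/-- Every member of the PROVED TYZ families is a `ℚ`-model of `E_m` with `m` square-free AND ODD (LLT / T5 / TYZρ:
`m ≡ 5, 7 (8)`; T7: `p₀ ≡ 7`, `pᵢ ≡ 1 (8)`; M35: `m = pq` odd). [folklore] -/
theorem exists_smul_congruentNumberCurve_odd_of_congruentTYZProvedFamily {W : WeierstrassCurve ℚ} [W.IsElliptic]
    [W.IsGloballyMinimal] (h : CongruentTYZProvedFamily W) :
    ∃ m : ℕ, Squarefree m ∧ m % 2 = 1 ∧ ∃ C : VariableChange ℚ, C • congruentNumberCurve m = W := by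
  rcases h with ⟨n, hsq, h8, -, -, C, hC⟩ | ⟨k, p, hp, hinj, -, h8, -, C, hC⟩ |
      ⟨k, p, hp, hinj, h0, h1, -, C, hC⟩ | ⟨p, q, hp, hq, hp8, hq8, C, hC⟩ | ⟨n, hsq, h8, -, -, -, C, hC⟩
  · exact ⟨n, hsq, by omega, C, hC⟩
  · exact ⟨_, HeathBrown1994.squarefree_prod_of_injective p hp hinj, by omega, C, hC⟩
  · refine ⟨_, HeathBrown1994.squarefree_prod_of_injective p hp hinj, prod_mod_two_eq_one fun i => ?_, C, hC⟩
    by_cases hi : i = 0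
    · subst hi; omega
    · have := h1 i hi; omega
  · refine ⟨p * q, ?_, ?_, C, hC⟩
    · have hpq : p ≠ q := by rintro rfl; omega
      rw [Nat.squarefree_mul_iff]
      exact ⟨(Nat.coprime_primes hp hq).2 hpq, hp.squarefree, hq.squarefree⟩
    · have hp2 : p % 2 = 1 := by omega
      have hq2 : q % 2 = 1 := by omega
      rw [Nat.mul_mod, hp2, hq2]
  · exact ⟨n, hsq, by omega, C, hC⟩

/-- **`𝒮⁻` is disjoint from the proved TYZ families**: a model of `E_{2pq}` is a model of no `E_m` with `m` odd
square-free (the square-free parameter of a model is unique, `CornerFTwo.Atlas.eq_of_smul_congruentNumberCurve`).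
[folklore] -/
theorem not_congruentTYZProvedFamily_of_congruentMonskySMinusFamily {W : WeierstrassCurve ℚ} [W.IsElliptic]
    [W.IsGloballyMinimal] (h : CongruentMonskySMinusFamily W) : ¬ CongruentTYZProvedFamily W := by
  intro hP
  obtain ⟨p, q, hp, hq, hp8, hq4, -, C, hC⟩ := h
  obtain ⟨m, hm, hm2, C', hC'⟩ := exists_smul_congruentNumberCurve_odd_of_congruentTYZProvedFamily hP
  have h := P2.CornerFTwo.Atlas.eq_of_smul_congruentNumberCurve (squarefree_two_mul_mul_of_sMinus hp hq hp8 hq4) hm hC hC'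
  omega

/-! ### §4. Glue (excluded middle on membership; the `𝒮⁻` / TYZProved disjointness for exactness) -/

/-- **The flag-free residual ⟺ the `𝒮⁻` leaf ∧ the flag-free residual off `𝒮⁻`** (EXACT). [folklore] -/
theorem wAllCornerFTwoRamifiedOffTYZProved_iff_sMinus_offSMinus :
    WAllCornerFTwoRamifiedOffTYZProved ↔
      WAllCornerFTwoRamifiedSMinus ∧ WAllCornerFTwoRamifiedOffTYZProvedOffSMinus := by
  constructor
  · intro h
    exact ⟨fun W _ _ hcm hr1 hram hS ↦
        h W hcm hr1 hram (not_congruentTYZProvedFamily_of_congruentMonskySMinusFamily hS),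
      fun W _ _ hcm hr1 hram hn _ ↦ h W hcm hr1 hram hn⟩
  · rintro ⟨hS, hO⟩ W _ _ hcm hr1 hram hn
    by_cases h1 : CongruentMonskySMinusFamily W
    · exact hS W hcm hr1 hram h1
    · exact hO W hcm hr1 hram hn h1

/-- The flag-free residual from the `𝒮⁻` leaf and the residual off `𝒮⁻`. [folklore] -/
theorem wAllCornerFTwoRamifiedOffTYZProved_of_sMinus_of_offSMinus (hS : WAllCornerFTwoRamifiedSMinus)
    (hO : WAllCornerFTwoRamifiedOffTYZProvedOffSMinus) : WAllCornerFTwoRamifiedOffTYZProved :=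
  wAllCornerFTwoRamifiedOffTYZProved_iff_sMinus_offSMinus.2 ⟨hS, hO⟩

/-- The `𝒮⁻` leaf is a restriction of the flag-free residual. [folklore] -/
theorem wAllCornerFTwoRamifiedSMinus_of_offTYZProved (h : WAllCornerFTwoRamifiedOffTYZProved) :
    WAllCornerFTwoRamifiedSMinus :=
  (wAllCornerFTwoRamifiedOffTYZProved_iff_sMinus_offSMinus.1 h).1

/-- … and the residual off `𝒮⁻` is the other restriction. [folklore] -/
theorem wAllCornerFTwoRamifiedOffTYZProvedOffSMinus_of_offTYZProved (h : WAllCornerFTwoRamifiedOffTYZProved) :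
    WAllCornerFTwoRamifiedOffTYZProvedOffSMinus :=
  (wAllCornerFTwoRamifiedOffTYZProved_iff_sMinus_offSMinus.1 h).2

/-- **The flag-free residual off `𝒮⁻` ⟺ (U⁺-road leaf off the proved families and off `𝒮⁻`) ∧ (FJ-atlas leaf, same
restriction) ∧ the five-way residual** (EXACT; pure logic) — the LITERAL / closed sub-slices stay attacked sub-slices of
the new residual, by name. [folklore] -/
theorem wAllCornerFTwoRamifiedOffTYZProvedOffSMinus_iff_uPlus_atlasFJ_offTYZOffSMinus :
    WAllCornerFTwoRamifiedOffTYZProvedOffSMinus ↔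
      (∀ (W : WeierstrassCurve ℚ) [W.IsElliptic] [W.IsGloballyMinimal],
          W.HasCM → W.analyticRank = 1 → CMRamified W 2 → ¬ CongruentTYZProvedFamily W →
            ¬ CongruentMonskySMinusFamily W → CongruentTYZUPlusFamily W → BSDp W 2) ∧
      (∀ (W : WeierstrassCurve ℚ) [W.IsElliptic] [W.IsGloballyMinimal],
          W.HasCM → W.analyticRank = 1 → CMRamified W 2 → ¬ CongruentTYZProvedFamily W →
            ¬ CongruentMonskySMinusFamily W → CongruentTYZAtlasFJFamily W → BSDp W 2) ∧
      WAllCornerFTwoRamifiedOffTYZOffSMinus := by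
  constructor
  · intro h
    exact ⟨fun W _ _ hcm hr1 hram hn hs _ ↦ h W hcm hr1 hram hn hs,
      fun W _ _ hcm hr1 hram hn hs _ ↦ h W hcm hr1 hram hn hs,
      fun W _ _ hcm hr1 hram hn _ _ hs ↦ h W hcm hr1 hram hn hs⟩
  · rintro ⟨hU, hF, hO⟩ W _ _ hcm hr1 hram hn hs
    by_cases h2 : CongruentTYZUPlusFamily W
    · exact hU W hcm hr1 hram hn hs h2
    · by_cases h3 : CongruentTYZAtlasFJFamily W
      · exact hF W hcm hr1 hram hn hs h3
      · exact hO W hcm hr1 hram hn h2 h3 hs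

/-- **The reshaped composition of crux `RamifiedOffTYZOfFacts`' skeleton**: U⁺-road leaf, FJ-atlas leaf, `𝒮⁻` leaf and
the five-way residual together give the flag-free residual `WAllCornerFTwoRamifiedOffTYZProved` (excluded middle only;
no disjointness needed in this direction). [folklore] -/
theorem wAllCornerFTwoRamifiedOffTYZProved_of_uPlus_of_atlasFJ_of_sMinus_of_offSMinus
    (hU : WAllCornerFTwoRamifiedTYZUPlus) (hF : WAllCornerFTwoRamifiedTYZAtlasFJ)
    (hS : WAllCornerFTwoRamifiedSMinus) (hO : WAllCornerFTwoRamifiedOffTYZOffSMinus) :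
    WAllCornerFTwoRamifiedOffTYZProved := by
  intro W _ _ hcm hr1 hram hn
  by_cases h1 : CongruentMonskySMinusFamily W
  · exact hS W hcm hr1 hram h1
  · by_cases h2 : CongruentTYZUPlusFamily W
    · exact hU W hcm hr1 hram h2
    · by_cases h3 : CongruentTYZAtlasFJFamily W
      · exact hF W hcm hr1 hram h3
      · exact hO W hcm hr1 hram hn h2 h3 h1

/-- **The four-way residual ⟺ its `𝒮⁻` part ∧ the five-way residual** (EXACT; pure logic), the `𝒮⁻` part spelled
out with the three non-membership binders. [folklore] -/
theorem wAllCornerFTwoRamifiedOffTYZ_iff_onSMinus_offSMinus :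
    WAllCornerFTwoRamifiedOffTYZ ↔
      (∀ (W : WeierstrassCurve ℚ) [W.IsElliptic] [W.IsGloballyMinimal],
          W.HasCM → W.analyticRank = 1 → CMRamified W 2 → ¬ CongruentTYZProvedFamily W →
            ¬ CongruentTYZUPlusFamily W → ¬ CongruentTYZAtlasFJFamily W → CongruentMonskySMinusFamily W →
            BSDp W 2) ∧
      WAllCornerFTwoRamifiedOffTYZOffSMinus := by
  constructor
  · intro h
    exact ⟨fun W _ _ hcm hr1 hram h1 h2 h3 _ ↦ h W hcm hr1 hram h1 h2 h3,
      fun W _ _ hcm hr1 hram h1 h2 h3 _ ↦ h W hcm hr1 hram h1 h2 h3⟩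
  · rintro ⟨hS, hO⟩ W _ _ hcm hr1 hram h1 h2 h3
    by_cases h4 : CongruentMonskySMinusFamily W
    · exact hS W hcm hr1 hram h1 h2 h3 h4
    · exact hO W hcm hr1 hram h1 h2 h3 h4

/-- **The four-way residual from the `𝒮⁻` leaf and the five-way residual** — the registered stub
`stub_offTYZ_residual` of crux 20509 REDUCES to the five-way residual once `𝒮⁻` is closed. [folklore] -/
theorem wAllCornerFTwoRamifiedOffTYZ_of_sMinus_of_offSMinus (hS : WAllCornerFTwoRamifiedSMinus)
    (hO : WAllCornerFTwoRamifiedOffTYZOffSMinus) : WAllCornerFTwoRamifiedOffTYZ :=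
  wAllCornerFTwoRamifiedOffTYZ_iff_onSMinus_offSMinus.2 ⟨fun W _ _ hcm hr1 hram _ _ _ h4 ↦ hS W hcm hr1 hram h4, hO⟩

/-- The five-way residual is a restriction of the four-way one. [folklore] -/
theorem wAllCornerFTwoRamifiedOffTYZOffSMinus_of_offTYZ (h : WAllCornerFTwoRamifiedOffTYZ) :
    WAllCornerFTwoRamifiedOffTYZOffSMinus :=
  (wAllCornerFTwoRamifiedOffTYZ_iff_onSMinus_offSMinus.1 h).2

/-- The `𝒮⁻` leaf is a restriction of the ramified slice … [folklore] -/
theorem wAllCornerFTwoRamifiedSMinus_of_wAllCornerFTwoRamified (h : WAllCornerFTwoRamified) :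
    WAllCornerFTwoRamifiedSMinus :=
  fun W _ _ hcm hr1 hram _ ↦ h W hcm hr1 hram

/-- … of row 12₂ … [folklore] -/
theorem wAllCornerFTwoRamifiedSMinus_of_wAllCornerFTwo (h : WAllCornerFTwo) : WAllCornerFTwoRamifiedSMinus :=
  wAllCornerFTwoRamifiedSMinus_of_wAllCornerFTwoRamified (wAllCornerFTwo_iff_slices.1 h).2.2.1

/-- … and of `WAll`. [folklore] -/
theorem wAllCornerFTwoRamifiedSMinus_of_wAll (h : WAll) : WAllCornerFTwoRamifiedSMinus :=
  wAllCornerFTwoRamifiedSMinus_of_wAllCornerFTwoRamified (cmTwoSlices_of_wAll h).2.2.1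

/-- The five-way residual follows from the ramified slice. [folklore] -/
theorem wAllCornerFTwoRamifiedOffTYZOffSMinus_of_wAllCornerFTwoRamified (h : WAllCornerFTwoRamified) :
    WAllCornerFTwoRamifiedOffTYZOffSMinus :=
  fun W _ _ hcm hr1 hram _ _ _ _ ↦ h W hcm hr1 hram

/-- The flag-free residual off `𝒮⁻` follows from the ramified slice. [folklore] -/
theorem wAllCornerFTwoRamifiedOffTYZProvedOffSMinus_of_wAllCornerFTwoRamified (h : WAllCornerFTwoRamified) :
    WAllCornerFTwoRamifiedOffTYZProvedOffSMinus :=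
  fun W _ _ hcm hr1 hram _ _ ↦ h W hcm hr1 hram

/-- **The ramified slice ⟺ ON the proved TYZ families ∧ ON `𝒮⁻` ∧ OFF both** (EXACT) — the three-way flag-free cut
the route `PrintCf2` can glue inside `𝔅_ram`. [folklore] -/
theorem wAllCornerFTwoRamified_iff_tyzProved_sMinus_offSMinus :
    WAllCornerFTwoRamified ↔ WAllCornerFTwoRamifiedTYZProved ∧ WAllCornerFTwoRamifiedSMinus ∧
      WAllCornerFTwoRamifiedOffTYZProvedOffSMinus := by
  rw [wAllCornerFTwoRamified_iff_tyzProved_offTYZProved, wAllCornerFTwoRamifiedOffTYZProved_iff_sMinus_offSMinus]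

/-- **Row 12₂ with the proved TYZ families AND `𝒮⁻` carved out (flag-free cut)**: `WAllCornerFTwo` ⟺ split-good ∧
split-bad ∧ (TYZProved ∧ SMinus ∧ OffTYZProvedOffSMinus) ∧ inert-good ∧ inert-bad. [folklore] -/
theorem wAllCornerFTwo_iff_slices_tyzProved_sMinus :
    WAllCornerFTwo ↔ WAllCornerFTwoSplitGood ∧ WAllCornerFTwoSplitBad ∧
      (WAllCornerFTwoRamifiedTYZProved ∧ WAllCornerFTwoRamifiedSMinus ∧
        WAllCornerFTwoRamifiedOffTYZProvedOffSMinus) ∧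
      WAllCornerFTwoInertGood ∧ WAllCornerFTwoInertBad := by
  rw [wAllCornerFTwo_iff_slices_tyzProved, wAllCornerFTwoRamifiedOffTYZProved_iff_sMinus_offSMinus]

end Summit.BirchSwinnertonDyer

end
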